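import Mathlib
import HarnessLib

/-!
# The FKR tearing-mode scalings and the patched constant-ψ dispersion relation AS PRINTED in Priest & Forbes
# §6.1–§6.2: `ω = [τ_d³τ_A²(kl)²]^{−1/5}`, the fastest mode `ω = (τ_dτ_A)^{−1/2}` at `kl = (τ_A/τ_d)^{1/4}`,
# (6.18) `ε⁴ = ω̄/(4k̄²L_u²)`, (6.21) `Δ′ = 3εω̄`, and the patching «`2/k̄ = 3εω̄ … ω̄ = [(8L_u)/(9k̄)]^{2/5}`» — PROVED

Topic `Literature/MathematicalPhysics/MHD` (namespace = path; sub-namespace `Tearing.FKRScalings`).  Companion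
to `TearingResistiveLayer.lean` (the exact constant-ψ layer with `Δ′ = C γ^{5/4}…`, `C` certified in
`TearingLayerMatchingConstant.lean`) and `TearingCurrentSlab.lean` (§10: «k̄ < 0.64», the growth-window lower
edge): here the DIMENSIONLESS bookkeeping of Priest–Forbes (`ω̄ = ωl²/η`, `k̄ = kl`, `L_u = τ_d/τ_A`) is typed and
the printed power laws are derived from the printed patching.  Written for GRIDFUSION (lit-3).

## Contents — every theorem PROVED (0 named facts, 0 sorry)
* §1 (§6.1) `fkrRate τ_d τ_A κ = [τ_d³τ_A²κ²]^{−1/5}`: at `κ = kl = 1` it is `τ_d^{−3/5}τ_A^{−2/5}` («The smallest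
  allowable wavelengths (l) grow in a time `τ_d^{3/5}τ_A^{2/5}`»); ★ at `κ = (τ_A/τ_d)^{1/4}` it is
  `(τ_dτ_A)^{−1/2}` («the longest wavelength … has the fastest growth-rate, namely `ω = (1/(τ_dτ_A))^{1/2}`»);
  monotonicity in `κ` (longer wavelength ⇒ faster).
* §2 (§6.2) `IsPatched L_u k̄ ω̄ ε`: (6.18) `ε⁴ = ω̄/(4k̄²L_u²)` and the patching of (6.17) (`k̄ ≪ 1`: `Δ′ ≃ 2/k̄`)
  with (6.21) `Δ′ = 3εω̄`: «`2/k̄ = 3εω̄`»; ★ `IsPatched.omega_eq : ω̄ = [(8L_u)/(9k̄)]^{2/5}` and the converse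
  `isPatched_of` (the printed dispersion relation IS the unique solution); the layer width that follows,
  `ε = [(8/9)^{2/5}/4]^{1/4} L_u^{−2/5} k̄^{−3/5}` (`IsPatched.eps_eq`).
READING OF THE PRINT (recorded, not adjudicated): §6.1 prints the layer width as
«`εl = (kl)^{−3/5}(τ_A/τ_d)^{−2/5} l`»; from (6.18) and the patched `ω̄ ∝ L_u^{2/5}` one gets `ε ∝ L_u^{−2/5} =
(τ_A/τ_d)^{+2/5}` (`IsPatched.eps_eq`), i.e. the exponent's sign as printed in §6.1 is the opposite of what
§6.2's formulas give (and of G&R (20.37), Schnack (34.29): the layer SHRINKS with the Lundquist number).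

## Sources, as printed (read on the page 2026-08-28)
* E. Priest, T. Forbes, *Magnetic Reconnection*, CUP 2000 [PriestForbes2000], §6.1 (the growth-rate display
  `ω = [τ_d³ τ_A² (kl)²]^{−1/5}`, «for wave-numbers … (τ_A/τ_d)^{1/4} < kl < 1 … ω = (1/(τ_d τ_A))^{1/2}»,
  «εl = (kl)^{−3/5}(τ_A/τ_d)^{−2/5} l»), §6.2 eqs. (6.8), (6.11), (6.17)–(6.21) and «2/k̄ = 3εω̄, or, after
  substituting for ε from Eq. (6.18), ω̄ = [(8L_u)/(9k̄)]^{2/5}»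
  [corpus:book:priest2000-magnetic-reconnection-mhd-theory-applications chunks p0179–p0184].
-/

noncomputable section

open Real

namespace Literature.MathematicalPhysics.MHD

namespace Tearing.FKRScalings

/-! ## §1 The §6.1 scalings -/

/-- THE FKR GROWTH RATE SCALING «`ω = [τ_d³ τ_A² (kl)²]^{−1/5}`» (`κ = kl`). [cite: PriestForbes2000, §6.1] -/
def fkrRate (τd τA κ : ℝ) : ℝ := (τd ^ 3 * τA ^ 2 * κ ^ 2) ^ (-(1 / 5) : ℝ)

/-- At `kl = 1`: `ω = τ_d^{−3/5} τ_A^{−2/5}` («The smallest allowable wavelengths (l) grow in a time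
`τ_d^{3/5}τ_A^{2/5}`»). [cite: PriestForbes2000, §6.1] -/
theorem fkrRate_one {τd τA : ℝ} (hd : 0 < τd) (hA : 0 < τA) :
    fkrRate τd τA 1 = τd ^ (-(3 / 5) : ℝ) * τA ^ (-(2 / 5) : ℝ) := by
  unfold fkrRate
  rw [one_pow, mul_one, Real.mul_rpow (by positivity) (by positivity),
    show τd ^ 3 = τd ^ (3 : ℝ) by norm_cast, show τA ^ 2 = τA ^ (2 : ℝ) by norm_cast,
    ← Real.rpow_mul hd.le, ← Real.rpow_mul hA.le]
  norm_num

/-- ★ At the longest wavelength `kl = (τ_A/τ_d)^{1/4}`: «the fastest growth-rate, namely `ω = (1/(τ_dτ_A))^{1/2}`».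
[cite: PriestForbes2000, §6.1] -/
theorem fkrRate_fastest {τd τA : ℝ} (hd : 0 < τd) (hA : 0 < τA) :
    fkrRate τd τA ((τA / τd) ^ (1 / 4 : ℝ)) = (1 / (τd * τA)) ^ (1 / 2 : ℝ) := by
  unfold fkrRate
  have hq : 0 < τA / τd := div_pos hA hd
  have e1 : ((τA / τd) ^ (1 / 4 : ℝ)) ^ 2 = (τA / τd) ^ (1 / 2 : ℝ) := by
    rw [← Real.rpow_natCast, ← Real.rpow_mul hq.le]; norm_num
  rw [e1]
  -- `τ_d³ τ_A² (τ_A/τ_d)^{1/2} = (τ_d τ_A)^{5/2}`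
  have e2 : τd ^ 3 * τA ^ 2 * (τA / τd) ^ (1 / 2 : ℝ) = (τd * τA) ^ (5 / 2 : ℝ) := by
    rw [Real.div_rpow hA.le hd.le, Real.mul_rpow hd.le hA.le]
    have hd5 : τd ^ (5 / 2 : ℝ) = τd ^ 3 / τd ^ (1 / 2 : ℝ) := by
      rw [eq_div_iff (by positivity), show τd ^ 3 = τd ^ (3 : ℝ) by norm_cast, ← Real.rpow_add hd]
      norm_num
    have hA5 : τA ^ (5 / 2 : ℝ) = τA ^ 2 * τA ^ (1 / 2 : ℝ) := by
      rw [show τA ^ 2 = τA ^ (2 : ℝ) by norm_cast, ← Real.rpow_add hA]; norm_num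
    rw [hd5, hA5]
    have : 0 < τd ^ (1 / 2 : ℝ) := by positivity
    field_simp
  rw [e2, ← Real.rpow_mul (by positivity), one_div (τd * τA), Real.inv_rpow (by positivity),
    ← Real.rpow_neg (by positivity)]
  norm_num

/-- Longer wavelengths grow faster: `fkrRate` is strictly decreasing in `κ > 0`.
[cite: PriestForbes2000, §6.1, Fig. 6.4] -/
theorem fkrRate_strictAnti {τd τA κ₁ κ₂ : ℝ} (hd : 0 < τd) (hA : 0 < τA) (h1 : 0 < κ₁) (h12 : κ₁ < κ₂) :
    fkrRate τd τA κ₂ < fkrRate τd τA κ₁ := by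
  unfold fkrRate
  have hlt : τd ^ 3 * τA ^ 2 * κ₁ ^ 2 < τd ^ 3 * τA ^ 2 * κ₂ ^ 2 := by
    have : κ₁ ^ 2 < κ₂ ^ 2 := by nlinarith
    exact mul_lt_mul_of_pos_left this (by positivity)
  exact Real.rpow_lt_rpow_of_neg (by positivity) hlt (by norm_num)

/-! ## §2 The patched constant-ψ dispersion relation (§6.2) -/

/-- THE PATCHED MODE: Lundquist number `L_u = τ_d/τ_A ≫ 1` (6.11), dimensionless wavenumber `k̄ = kl`, growth
rate `ω̄ = ωl²/η` (6.8) and layer half-width `ε` with (6.18) `ε⁴ = ω̄/(4k̄²L_u²)` and the patching of the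
long-wave outer index `Δ′ ≃ 2/k̄` (6.17) with the constant-ψ inner result `Δ′ = 3εω̄` (6.21): «`2/k̄ = 3εω̄`».
[cite: PriestForbes2000, §6.2 eqs. (6.17), (6.18), (6.21)] -/
structure IsPatched (Lu kbar ω ε : ℝ) : Prop where
  Lu_pos : 0 < Lu
  kbar_pos : 0 < kbar
  ω_pos : 0 < ω
  ε_pos : 0 < ε
  width : ε ^ 4 = ω / (4 * kbar ^ 2 * Lu ^ 2)
  patch : 2 / kbar = 3 * ε * ω

namespace IsPatched

variable {Lu kbar ω ε : ℝ} (h : IsPatched Lu kbar ω ε)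
include h

/-- `ω̄⁵ = (8L_u/(9k̄))²` (raise the patching to the fourth power and use (6.18)).
[cite: PriestForbes2000, §6.2, after eq. (6.21)] -/
theorem omega_pow_five : ω ^ 5 = (8 * Lu / (9 * kbar)) ^ 2 := by
  have hk := h.kbar_pos.ne'; have hL := h.Lu_pos.ne'
  have hp := h.patch; have hw := h.width
  -- `(3εω̄)⁴ = (2/k̄)⁴`, `ε⁴ = ω̄/(4k̄²L_u²)` ⇒ `81 ω̄⁵/(4k̄²L_u²) = 16/k̄⁴`
  have h4 : (3 * ε * ω) ^ 4 = (2 / kbar) ^ 4 := by rw [hp]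
  have e : (3 * ε * ω) ^ 4 = 81 * ε ^ 4 * ω ^ 4 := by ring
  rw [e, hw] at h4
  field_simp at h4
  field_simp
  nlinarith [h4]

/-- ★ «`ω̄ = [(8L_u)/(9k̄)]^{2/5}`». [cite: PriestForbes2000, §6.2, after eq. (6.21)] -/
theorem omega_eq : ω = (8 * Lu / (9 * kbar)) ^ (2 / 5 : ℝ) := by
  have h5 := h.omega_pow_five
  have hX : 0 < 8 * Lu / (9 * kbar) := div_pos (by linarith [h.Lu_pos]) (by linarith [h.kbar_pos])
  have hω := h.ω_pos
  have : ω = (ω ^ 5) ^ (1 / 5 : ℝ) := by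
    rw [← Real.rpow_natCast, ← Real.rpow_mul hω.le]; norm_num
  rw [this, h5, ← Real.rpow_natCast, ← Real.rpow_mul hX.le]
  norm_num

/-- The layer width that follows: `ε⁴ = (8/9)^{2/5}/4 · L_u^{−8/5} k̄^{−12/5}`, i.e.
`ε ∝ L_u^{−2/5} k̄^{−3/5}` — the layer SHRINKS with `L_u = τ_d/τ_A` (READING OF THE PRINT: §6.1 has
«(τ_A/τ_d)^{−2/5}»). [cite: PriestForbes2000, §6.1, §6.2 eq. (6.18)] -/
theorem eps_pow_four :
    ε ^ 4 = (8 / 9 : ℝ) ^ (2 / 5 : ℝ) / 4 * (Lu ^ (-(8 / 5) : ℝ) * kbar ^ (-(12 / 5) : ℝ)) := by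
  rw [h.width, h.omega_eq]
  have hL := h.Lu_pos; have hk := h.kbar_pos
  rw [Real.div_rpow (by positivity) (by positivity), Real.mul_rpow (by norm_num) hL.le,
    Real.mul_rpow (by norm_num) hk.le, Real.div_rpow (by norm_num) (by norm_num)]
  have e1 : Lu ^ (-(8 / 5) : ℝ) = Lu ^ (2 / 5 : ℝ) / Lu ^ 2 := by
    rw [eq_div_iff (by positivity), show Lu ^ 2 = Lu ^ (2 : ℝ) by norm_cast, ← Real.rpow_add hL]; norm_num
  have e2 : kbar ^ (-(12 / 5) : ℝ) = 1 / (kbar ^ (2 / 5 : ℝ) * kbar ^ 2) := by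
    rw [eq_div_iff (by positivity), show kbar ^ 2 = kbar ^ (2 : ℝ) by norm_cast, ← Real.rpow_add hk,
      ← Real.rpow_add hk]; norm_num
  rw [e1, e2]
  have : 0 < kbar ^ (2 / 5 : ℝ) := by positivity
  have : 0 < (9 : ℝ) ^ (2 / 5 : ℝ) := by positivity
  field_simp

end IsPatched

/-- Conversely the printed dispersion relation IS a patched mode: with `ω̄ = [(8L_u)/(9k̄)]^{2/5}` and
`ε = (ω̄/(4k̄²L_u²))^{1/4}` both (6.18) and «2/k̄ = 3εω̄» hold. [cite: PriestForbes2000, §6.2, after eq. (6.21)] -/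
theorem isPatched_of {Lu kbar : ℝ} (hL : 0 < Lu) (hk : 0 < kbar) :
    IsPatched Lu kbar ((8 * Lu / (9 * kbar)) ^ (2 / 5 : ℝ))
      ((((8 * Lu / (9 * kbar)) ^ (2 / 5 : ℝ)) / (4 * kbar ^ 2 * Lu ^ 2)) ^ (1 / 4 : ℝ)) := by
  set ω := (8 * Lu / (9 * kbar)) ^ (2 / 5 : ℝ) with hω
  have hX : 0 < 8 * Lu / (9 * kbar) := by positivity
  have hωp : 0 < ω := Real.rpow_pos_of_pos hX _
  have hq : 0 < ω / (4 * kbar ^ 2 * Lu ^ 2) := by positivity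
  set ε := (ω / (4 * kbar ^ 2 * Lu ^ 2)) ^ (1 / 4 : ℝ) with hε
  have hεp : 0 < ε := Real.rpow_pos_of_pos hq _
  have hw : ε ^ 4 = ω / (4 * kbar ^ 2 * Lu ^ 2) := by
    rw [hε, ← Real.rpow_natCast, ← Real.rpow_mul hq.le]; norm_num
  refine ⟨hL, hk, hωp, hεp, hw, ?_⟩
  -- `ω⁵ = (8L_u/(9k̄))²`, so `(3εω)⁴ = 81 ε⁴ ω⁴ = 81 ω⁵/(4k̄²L_u²) = 16/k̄⁴ = (2/k̄)⁴`
  have h5 : ω ^ 5 = (8 * Lu / (9 * kbar)) ^ 2 := by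
    rw [hω, ← Real.rpow_natCast, ← Real.rpow_mul hX.le]; norm_num
  have h4 : (3 * ε * ω) ^ 4 = (2 / kbar) ^ 4 := by
    rw [show (3 * ε * ω) ^ 4 = 81 * ε ^ 4 * ω ^ 4 by ring, hw]
    have hk0 := hk.ne'; have hL0 := hL.ne'
    have h5' : ω ^ 5 * (81 * kbar ^ 2) = 64 * Lu ^ 2 := by
      rw [h5]; field_simp; ring
    field_simp
    linear_combination h5'
  have hpos : 0 < 3 * ε * ω := by positivity
  exact ((pow_left_inj₀ (by positivity) hpos.le four_ne_zero).1 h4.symm).symm ▸ rfl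

end Tearing.FKRScalings

end Literature.MathematicalPhysics.MHD
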